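/-
Copyright: the b2b-balaban T⁴-continuum CRUX team, row NE7b owner lineage `t4-ne7b-p1` (gen 113). Project licence.
-/
import Summits.QuantumFields.BalabanUV.T4Continuum.Spine.NE7b.BlockPropagatorSupNorm

/-!
# THE BLOCK-AVERAGED MASSIVE PROPAGATOR SMOOTHS AT THE BLOCK SCALE IN THE SUP CURRENCY, UNIFORMLY IN THE MESH: for
# `G′ = (Δ^η + aQ′*Q′)⁻¹` on `ℤ^d` (`B5Hk103ScalarZd.Gk`), `d ≥ 3`, there is `A′(d,a)` with, for EVERY side `n + 1`, every `p`, `μ`: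
# `Σ′_q |G′(p+e_μ,q) − G′(p,q)| ≤ A′·(n+1)⁻¹` — i.e. `‖∇^η G′‖_{ℓ^∞→ℓ^∞} ≤ A′` (`∇^η = (n+1)·∇`), the gradient half of
# [B5] (1.115)'s KIND of letter for the scalar `ℤ^d` object, BY PROOF, from the β-team's gradient legs
# `PointColumnSplit.abs_Gk_diff_sub_free_le` (near: `∇(G′ − η²G₀) = O(η^{d+1})`) and `PointColumnDecay.abs_Gk_diff_far_le` (far)
# (row NE7b, node U5c; companion of (49) `BlockPropagatorSupNorm`; [folklore] bookkeeping)

Cell `pub-balaban`, sub-cell `t4`, spine estimate NE7b (`T4WeightBudget.RelWeightBound`; the cell's OWN estimate — NOT PRINTED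
in [Bałaban 1983–89], NOT PROVED).  Crux-route work under `Spine/NE7b/` by the row OWNER (`t4-ne7b-p1` gen 113) under FREEZE
(0)'s crux-prover clause (RULING W-ne7bp1-g113-1, FILING-CLAIM C-ne7bp1-g113-5); NOTHING of Bałaban's is asserted; no
`T4Continuum/Support` leaf typed; no `def` (the gradient envelope constant `C₁(d)` of `PoissonInterior.G₀_diff_bound` is existential,
so the letters are stated `∃ A′, …` — honest: every constant here is existential in `d` anyway); zero `sorry`.  Imports (BY NAME):
(49) `BlockPropagatorSupNorm` (`floor_sq_exp_le`, `summable_abs_Gk_row`) and through it the β-team's `PointColumnSplit` ∕ `PointColumnDecay`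
and the Literature columns (`Gk`, `G₀`, `nrm`, `tsum_blocks`).

WHY.  (49) typed `‖G′‖_{ℓ^∞→ℓ^∞} ≤ A·K_d` uniformly in the mesh; print's small-field analysis also differentiates the fields the
propagators produce ((1.65) ∕ (1.115): value AND gradient).  The β-team's point-column legs come in pairs (value, forward difference
with one extra mesh factor); summing the gradient legs over blocks exactly as in (49) — near blocks through the Newton GRADIENT
envelope `|∇G₀(v)| ≤ C₁∕nrm v^{d−1}` (`η²·Σ_{block} nrm^{1−d} ≤ C₁·cKL(d,d−1)·η²·(n+1) = O(η)`) plus `(n+1)^d` entries of size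
`cSplit·η^{d+1}`, far blocks through `cFar·k²·η^{d+1}·e^{−4δ_u k}` — gives the gradient row with ONE factor `(n+1)⁻¹`: in `η`-units the
`η`-gradient of `G′f` is bounded by `A′‖f‖_∞`, mesh-free.  Bookkeeping only; the analysis is pv23's `PoissonInterior` and the β-team's.

WHAT IS PROVED ([folklore]; `d ≥ 3`, `a > 0`; every `n : ℕ`, `p : ℤ^d`, `μ : Fin d`):
* §1 `sum_block_inv_nrm_pow_pred_le` (`Σ_{q∈B(y)} nrm(p−q)^{−(d−1)} ≤ cKL(d,d−1)·(n+1)`), **`exists_sum_block_abs_Gk_diff_le_unif`**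
  (`∃ N ≥ 0`, EVERY block: `Σ_{q∈B(y)} |G′(p+e_μ,q) − G′(p,q)| ≤ N·(n+1)⁻¹`, `N = C₁·cKL(d,d−1) + cSplit`).
* §2 **`sum_block_abs_Gk_diff_le_far`** (`8 ≤ |blk p − y|`: `≤ cFar·e^{4δ_u}∕δ_u²·(n+1)⁻¹·e^{−(δ_u∕4)|blk p − y|}` — explicit).
* §3 **`exists_sum_block_abs_Gk_diff_le`** (`∃ A′ ≥ 0`, EVERY block: `≤ A′·(n+1)⁻¹·e^{−(δ_u∕4)|blk p − y|}`), `summable_abs_Gk_diff_row`,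
  **`exists_tsum_abs_Gk_diff_le`** (`∃ A′ ≥ 0, ∀ n p μ, Σ′_q |G′(p+e_μ,q) − G′(p,q)| ≤ A′·(n+1)⁻¹` — **`‖∇^η G′‖_{ℓ^∞→ℓ^∞} ≤ A′`
  UNIFORMLY IN THE MESH**).
* §4 **`exists_gradient_letter_Gk`** (`∃ A′ ≥ 0, ∀ n p μ f R, |f| ≤ R → |Σ′_q (G′(p+e_μ,q) − G′(p,q))·f(q)| ≤ A′·(n+1)⁻¹·R`).
* §5 toy.

HONEST (what this is NOT).  Constants existential (stated so); forward differences in the FIRST slot only (the second slot follows by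
`Gk_symm` for the value but is not typed here); scalar `ℤ^d`, no torus, nothing of the covariant propagators ((A3), NC-NE7b-α UNRULED).
BY-NAME EFFECT ON THE WALL: NONE.  NE7b NOT PRINTED ∕ NOT PROVED; spine PROVED 0∕9; rung (B)+1 on a FINITE torus — NOT infinite volume,
NOT the mass gap, NOT Clay.  HONEST DEPENDENCY: continuum YM on T⁴ ⇐ BetaPertH ∧ nine spine estimates (0∕9 proved); BetaPertH ⇐ (D1)
∧ (D4) ∧ CAP+tail; G-an2-4 gates asym, D1 and NE2∕3∕4.
-/

set_option autoImplicit false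

namespace Summit.QuantumFields.BalabanUV.T4Continuum.NE7b.BlockPropagatorSupGradient

open Finset Real
open Literature.MathematicalPhysics.QuantumFieldTheory.Balaban1983to89
open B4Sect5Proof (latticeConst latticeConst_nonneg)
open B6QGQLower276 (X e blk B mem_B sum_B_const)
open B6QGQDecay237 (deltaU deltaU_pos)
open B5Hk103ScalarZd (Gk summable_expX tsum_expX_le tsum_blocks summable_blocks)
open Beta.PoissonInterior (nrm one_le_nrm nrm_pos nrm_neg G₀ G₀_diff_bound)
open Summit.QuantumFields.BalabanUV.Beta.D1BFx.PointColumnSplit (cKL one_le_cKL sum_block_inv_nrm_pow_le cSplit cSplit_nonneg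
  abs_Gk_diff_sub_free_le)
open Summit.QuantumFields.BalabanUV.Beta.D1BFx.PointColumnDecay (cFar cFar_pos abs_Gk_diff_far_le)
open BlockPropagatorSupNorm (floor_sq_exp_le summable_abs_Gk_row)

noncomputable section

variable {d : ℕ}

/-! ## §1. Near field: every block carries `O((n+1)⁻¹)` gradient mass -/

/-- `Σ_{q∈B(y)} nrm(p − q)^{−(d−1)} ≤ cKL(d,d−1)·(n+1)` for every block and every `p` (`d ≥ 1`; `PointColumnSplit.sum_block_inv_nrm_pow_le`
at `e = d − 1`, `nrm(−v) = nrm v`). [folklore] -/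
theorem sum_block_inv_nrm_pow_pred_le (hd : 3 ≤ d) (n : ℕ) (p y : X d) :
    ∑ q ∈ B n y, 1 / nrm (p - q) ^ (d - 1) ≤ cKL d (d - 1) * ((n : ℝ) + 1) := by
  have hd0 : 0 < d := by omega
  have h := sum_block_inv_nrm_pow_le hd0 (le_refl (d - 1)) n y p
  rw [show d - (d - 1) = 1 by omega, pow_one] at h
  refine le_trans (le_of_eq (Finset.sum_congr rfl fun q _ => ?_)) h
  rw [← nrm_neg, neg_sub]

/-- **THE NEAR-FIELD GRADIENT LETTER** (`d ≥ 3`): there is `N = C₁·cKL(d,d−1) + cSplit(d,a) ≥ 0` such that for EVERY side, block and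
direction `Σ_{q∈B(y)} |G′(p+e_μ,q) − G′(p,q)| ≤ N·(n+1)⁻¹` — the Newton gradient envelope `|∇G₀| ≤ C₁∕nrm^{d−1}` summed over a block
(`O(n+1)`) times `η²`, plus `(n+1)^d` entries of size `cSplit·η^{d+1}` (`abs_Gk_diff_sub_free_le`). [folklore] -/
theorem exists_sum_block_abs_Gk_diff_le_unif (hd : 3 ≤ d) {a : ℝ} (ha : 0 < a) :
    ∃ N : ℝ, 0 ≤ N ∧ ∀ (n : ℕ) (p y : X d) (μ : Fin d),
      ∑ q ∈ B n y, |Gk n a (p + e μ) q - Gk n a p q| ≤ N / ((n : ℝ) + 1) := by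
  obtain ⟨C₁, hC₁, hG⟩ := G₀_diff_bound hd
  refine ⟨C₁ * cKL d (d - 1) + cSplit d a, by have := one_le_cKL d (d - 1); have := cSplit_nonneg d ha; positivity,
    fun n p y μ => ?_⟩
  have hs : (0 : ℝ) < (n : ℝ) + 1 := by positivity
  have hpt : ∀ q : X d, |Gk n a (p + e μ) q - Gk n a p q|
      ≤ C₁ * (1 / nrm (p - q) ^ (d - 1)) / ((n : ℝ) + 1) ^ 2 + cSplit d a / ((n : ℝ) + 1) ^ (d + 1) := by
    intro q
    have h := abs_Gk_diff_sub_free_le hd n ha p q μ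
    have htri := abs_sub_abs_le_abs_sub (Gk n a (p + e μ) q - Gk n a p q)
      ((G₀ (p + e μ - q) - G₀ (p - q)) / ((n : ℝ) + 1) ^ 2)
    have hfree : |(G₀ (p + e μ - q) - G₀ (p - q)) / ((n : ℝ) + 1) ^ 2| ≤ C₁ * (1 / nrm (p - q) ^ (d - 1)) / ((n : ℝ) + 1) ^ 2 := by
      rw [abs_div, abs_of_pos (pow_pos hs 2)]
      refine div_le_div_of_nonneg_right ?_ (pow_pos hs 2).le
      have h1 := (hG (p - q) μ).1
      rw [show p - q + Pi.single μ (1 : ℤ) = p + e μ - q by rw [e]; abel] at h1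
      exact h1.trans (le_of_eq (by ring))
    linarith
  calc ∑ q ∈ B n y, |Gk n a (p + e μ) q - Gk n a p q|
      ≤ ∑ q ∈ B n y, (C₁ * (1 / nrm (p - q) ^ (d - 1)) / ((n : ℝ) + 1) ^ 2 + cSplit d a / ((n : ℝ) + 1) ^ (d + 1)) :=
        Finset.sum_le_sum fun q _ => hpt q
    _ = C₁ * (∑ q ∈ B n y, 1 / nrm (p - q) ^ (d - 1)) / ((n : ℝ) + 1) ^ 2
          + ((n : ℝ) + 1) ^ d * (cSplit d a / ((n : ℝ) + 1) ^ (d + 1)) := by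
        rw [Finset.sum_add_distrib, sum_B_const, ← Finset.sum_div, ← Finset.mul_sum]
    _ ≤ C₁ * (cKL d (d - 1) * ((n : ℝ) + 1)) / ((n : ℝ) + 1) ^ 2
          + ((n : ℝ) + 1) ^ d * (cSplit d a / ((n : ℝ) + 1) ^ (d + 1)) := by
        gcongr
        exact sum_block_inv_nrm_pow_pred_le hd n p y
    _ = (C₁ * cKL d (d - 1) + cSplit d a) / ((n : ℝ) + 1) := by
        rw [pow_succ]; field_simp; ring

/-! ## §2. Far field: explicit -/

/-- **THE FAR-FIELD GRADIENT LETTER** (`d ≥ 3`): for a block at separation `D = |blk p − y|_∞ ≥ 8`,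
`Σ_{q∈B(y)} |G′(p+e_μ,q) − G′(p,q)| ≤ cFar(d,a)·e^{4δ_u}∕δ_u²·(n+1)⁻¹·e^{−(δ_u∕4)D}` (`PointColumnDecay.abs_Gk_diff_far_le`, `k = ⌊D∕8⌋`). [folklore] -/
theorem sum_block_abs_Gk_diff_le_far (hd : 3 ≤ d) (n : ℕ) {a : ℝ} (ha : 0 < a) (p y : X d) (μ : Fin d)
    (hD : 8 ≤ dist (blk n p) y) :
    ∑ q ∈ B n y, |Gk n a (p + e μ) q - Gk n a p q|
      ≤ cFar d a * Real.exp (4 * deltaU d a) / deltaU d a ^ 2 / ((n : ℝ) + 1)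
        * Real.exp (-(deltaU d a / 4 * dist (blk n p) y)) := by
  have hδ := deltaU_pos d ha
  obtain ⟨hk1, hk8, hksq⟩ := floor_sq_exp_le hδ hD
  set k : ℕ := ⌊dist (blk n p) y / 8⌋₊ with hk
  have hs : (0 : ℝ) < (n : ℝ) + 1 := by positivity
  have hpt : ∀ q ∈ B n y, |Gk n a (p + e μ) q - Gk n a p q|
      ≤ cFar d a * (k : ℝ) ^ 2 / ((n : ℝ) + 1) ^ (d + 1) * Real.exp (-(4 * deltaU d a * k)) := by
    intro q hq
    have hy : blk n q = y := mem_B.1 hq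
    exact abs_Gk_diff_far_le hd n ha p q hk1 (by rw [hy]; exact hk8) μ
  calc ∑ q ∈ B n y, |Gk n a (p + e μ) q - Gk n a p q|
      ≤ ∑ q ∈ B n y, cFar d a * (k : ℝ) ^ 2 / ((n : ℝ) + 1) ^ (d + 1) * Real.exp (-(4 * deltaU d a * k)) :=
        Finset.sum_le_sum hpt
    _ = cFar d a / ((n : ℝ) + 1) * ((k : ℝ) ^ 2 * Real.exp (-(4 * deltaU d a * k))) := by
        rw [sum_B_const, pow_succ]; field_simp; ring
    _ ≤ cFar d a / ((n : ℝ) + 1) * (Real.exp (4 * deltaU d a) / deltaU d a ^ 2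
          * Real.exp (-(deltaU d a / 4 * dist (blk n p) y))) :=
        mul_le_mul_of_nonneg_left hksq (div_nonneg (cFar_pos d ha).le hs.le)
    _ = _ := by ring

/-! ## §3. Every block and the whole row: `‖∇^η G′‖_{ℓ^∞→ℓ^∞} ≤ A′` uniformly in the mesh -/

/-- **EVERY BLOCK** (`d ≥ 3`): `∃ A′ ≥ 0` with `Σ_{q∈B(y)} |G′(p+e_μ,q) − G′(p,q)| ≤ A′·(n+1)⁻¹·e^{−(δ_u∕4)|blk p − y|_∞}` for every side, `p`,
`y`, `μ` (`A′ = N·e^{2δ_u} + cFar·e^{4δ_u}∕δ_u²`). [folklore] -/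
theorem exists_sum_block_abs_Gk_diff_le (hd : 3 ≤ d) {a : ℝ} (ha : 0 < a) :
    ∃ A : ℝ, 0 ≤ A ∧ ∀ (n : ℕ) (p y : X d) (μ : Fin d),
      ∑ q ∈ B n y, |Gk n a (p + e μ) q - Gk n a p q|
        ≤ A / ((n : ℝ) + 1) * Real.exp (-(deltaU d a / 4 * dist (blk n p) y)) := by
  obtain ⟨N, hN0, hN⟩ := exists_sum_block_abs_Gk_diff_le_unif hd ha
  have hδ := deltaU_pos d ha
  have hfar0 : 0 ≤ cFar d a * Real.exp (4 * deltaU d a) / deltaU d a ^ 2 := by have := cFar_pos d ha; positivity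
  refine ⟨N * Real.exp (2 * deltaU d a) + cFar d a * Real.exp (4 * deltaU d a) / deltaU d a ^ 2, by positivity,
    fun n p y μ => ?_⟩
  have hs : (0 : ℝ) < (n : ℝ) + 1 := by positivity
  have hE : 0 < Real.exp (-(deltaU d a / 4 * dist (blk n p) y)) := Real.exp_pos _
  by_cases hD : 8 ≤ dist (blk n p) y
  · have h := sum_block_abs_Gk_diff_le_far hd n ha p y μ hD
    have h2 : 0 ≤ N * Real.exp (2 * deltaU d a) / ((n : ℝ) + 1) * Real.exp (-(deltaU d a / 4 * dist (blk n p) y)) := by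
      positivity
    calc _ ≤ _ := h
      _ ≤ _ := by rw [add_div, add_mul]; linarith
  · rw [not_le] at hD
    have h := hN n p y μ
    have hexp : 1 ≤ Real.exp (2 * deltaU d a) * Real.exp (-(deltaU d a / 4 * dist (blk n p) y)) := by
      rw [← Real.exp_add]; exact Real.one_le_exp (by nlinarith)
    have h1 : N / ((n : ℝ) + 1)
        ≤ N * Real.exp (2 * deltaU d a) / ((n : ℝ) + 1) * Real.exp (-(deltaU d a / 4 * dist (blk n p) y)) := by
      calc N / ((n : ℝ) + 1)
          ≤ N / ((n : ℝ) + 1) * (Real.exp (2 * deltaU d a) * Real.exp (-(deltaU d a / 4 * dist (blk n p) y))) :=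
            le_mul_of_one_le_right (div_nonneg hN0 hs.le) hexp
        _ = _ := by ring
    have h2 : 0 ≤ cFar d a * Real.exp (4 * deltaU d a) / deltaU d a ^ 2 / ((n : ℝ) + 1)
        * Real.exp (-(deltaU d a / 4 * dist (blk n p) y)) := by positivity
    calc _ ≤ N / ((n : ℝ) + 1) := h
      _ ≤ _ := by rw [add_div, add_mul]; linarith

/-- The gradient row `q ↦ |G′(p+e_μ,q) − G′(p,q)|` is summable (every `d`). [folklore] -/
theorem summable_abs_Gk_diff_row (n : ℕ) {a : ℝ} (ha : 0 < a) (p : X d) (μ : Fin d) :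
    Summable fun q : X d => |Gk n a (p + e μ) q - Gk n a p q| :=
  Summable.of_nonneg_of_le (fun _ => abs_nonneg _) (fun _ => abs_sub _ _)
    ((summable_abs_Gk_row n ha (p + e μ)).add (summable_abs_Gk_row n ha p))

/-- **`‖∇^η G′‖_{ℓ^∞→ℓ^∞} ≤ A′·K_d(δ_u∕4)` UNIFORMLY IN THE MESH** (`d ≥ 3`): `∃ A′ ≥ 0` with
`Σ′_q |G′(p+e_μ,q) − G′(p,q)| ≤ A′·(n+1)⁻¹` for every side, `p`, `μ` — the gradient half of [B5] (1.115)'s kind of letter for the scalar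
`ℤ^d` block-averaged massive propagator, by proof. [folklore] -/
theorem exists_tsum_abs_Gk_diff_le (hd : 3 ≤ d) {a : ℝ} (ha : 0 < a) :
    ∃ A : ℝ, 0 ≤ A ∧ ∀ (n : ℕ) (p : X d) (μ : Fin d),
      ∑' q : X d, |Gk n a (p + e μ) q - Gk n a p q| ≤ A / ((n : ℝ) + 1) := by
  obtain ⟨A, hA0, hA⟩ := exists_sum_block_abs_Gk_diff_le hd ha
  have hδ4 : 0 < deltaU d a / 4 := by have := deltaU_pos d ha; positivity
  refine ⟨A * latticeConst d (deltaU d a / 4), mul_nonneg hA0 (latticeConst_nonneg d hδ4.le), fun n p μ => ?_⟩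
  have hs : (0 : ℝ) < (n : ℝ) + 1 := by positivity
  have hmaj : Summable fun y : X d => A / ((n : ℝ) + 1) * Real.exp (-(deltaU d a / 4 * dist (blk n p) y)) :=
    (summable_expX hδ4 (blk n p)).mul_left _
  rw [← tsum_blocks n (summable_abs_Gk_diff_row n ha p μ)]
  calc ∑' y : X d, ∑ q ∈ B n y, |Gk n a (p + e μ) q - Gk n a p q|
      ≤ ∑' y : X d, A / ((n : ℝ) + 1) * Real.exp (-(deltaU d a / 4 * dist (blk n p) y)) :=
        Summable.tsum_le_tsum (fun y => hA n p y μ) (summable_blocks n (summable_abs_Gk_diff_row n ha p μ)) hmaj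
    _ = A / ((n : ℝ) + 1) * ∑' y : X d, Real.exp (-(deltaU d a / 4 * dist (blk n p) y)) := tsum_mul_left
    _ ≤ A / ((n : ℝ) + 1) * latticeConst d (deltaU d a / 4) :=
        mul_le_mul_of_nonneg_left (tsum_expX_le hδ4 (blk n p)) (div_nonneg hA0 hs.le)
    _ = A * latticeConst d (deltaU d a / 4) / ((n : ℝ) + 1) := by ring

/-! ## §4. The gradient of `G′f` for bounded `f` -/

/-- **THE GRADIENT LETTER FOR `G′`** (`d ≥ 3`): `∃ A′ ≥ 0` such that for every side, `p`, `μ` and every `|f| ≤ R`,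
`|Σ′_q (G′(p+e_μ,q) − G′(p,q))·f(q)| ≤ A′·(n+1)⁻¹·R` — `‖∇(G′f)‖_∞ ≤ A′·M⁻¹·‖f‖_∞`. [folklore] -/
theorem exists_gradient_letter_Gk (hd : 3 ≤ d) {a : ℝ} (ha : 0 < a) :
    ∃ A : ℝ, 0 ≤ A ∧ ∀ (n : ℕ) (p : X d) (μ : Fin d) (f : X d → ℝ) (R : ℝ), (∀ q, |f q| ≤ R) →
      |∑' q : X d, (Gk n a (p + e μ) q - Gk n a p q) * f q| ≤ A / ((n : ℝ) + 1) * R := by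
  obtain ⟨A, hA0, hA⟩ := exists_tsum_abs_Gk_diff_le hd ha
  refine ⟨A, hA0, fun n p μ f R hf => ?_⟩
  have hR : 0 ≤ R := (abs_nonneg _).trans (hf 0)
  have hsum : HasSum (fun q : X d => |Gk n a (p + e μ) q - Gk n a p q| * R)
      ((∑' q : X d, |Gk n a (p + e μ) q - Gk n a p q|) * R) :=
    (summable_abs_Gk_diff_row n ha p μ).hasSum.mul_right R
  have h := tsum_of_norm_bounded hsum fun q => by
    rw [Real.norm_eq_abs, abs_mul]
    exact mul_le_mul_of_nonneg_left (hf q) (abs_nonneg _)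
  rw [Real.norm_eq_abs] at h
  exact h.trans (mul_le_mul_of_nonneg_right (hA n p μ) hR)

/-! ## §5. Toy -/

/-- Toy: the shape of §3's constant assembly — `N∕(n+1) ≤ (N·e^{2δ} + F)∕(n+1)·e^{−δD∕4}` needs only `1 ≤ e^{2δ}·e^{−δD∕4}` for `D < 8`;
at `δ = 1`, `D = 4`: `1 ≤ e^{2}·e^{−1}`. -/
example : (1 : ℝ) ≤ Real.exp (2 * 1) * Real.exp (-(1 / 4 * 4)) := by
  rw [← Real.exp_add]; exact Real.one_le_exp (by norm_num)

end

end Summit.QuantumFields.BalabanUV.T4Continuum.NE7b.BlockPropagatorSupGradient
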